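import Summits.Ventures.LatticeQCDFlow.Scaling.HubListsSharpLaw
import Summits.Ventures.LatticeQCDFlow.Scaling.GroundStatePoincare

/-!
HONEST FRAMING: exact (Metropolis-corrected) sampling algorithms for lattice gauge theory; figures
of merit are autocorrelation/cost numbers at stated couplings and volumes; no continuum-physics
claim.

# HomLadderSharpLaw — THE HOMOGENEOUS LADDER THROUGH THE GROUND-STATE MACHINERY ALONE (no cosines): THE ADJACENT LIST IS CONNECTED, EVERY LEVEL IS WITHIN `K` PAIRS OF THE HOT ONE,
# `max{K(K+1)(2K+1)/(6t), (K+1)/h} ≤ 1/ρ ≤ max{K²(K+1)/t, 2(K+1)/h}`, PARTICIPATION `Σc/√(Σc²) ≥ √((K+1)/6)`, HENCE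
# **`((1−ρ)/ρ)·log((1−ν(u))·√((K+1)/6)/4) ≤ t_mix(1/4) ≤ ⌈(1/ρ)·log(4h/ρ)⌉`** FOR `t·ptBareSwap ν^{⊗} + (1−t)·prodKernel w M` — CHAPTER AG'S `Θ(max{K³/t, K/h}·log K)` RECOVERED
# WITH BETTER CONSTANTS (lean-2 GEN-48, ours)

Venture-side (OURS).  Cell `lqcd-flow` (pub-lqcd), unit `pub-lqcd-lean-2-g48`, 2026-08-31.  Chapter AI (the sizes of the Robin ground state), file 6 — parents AI5 `HubListsSharpLaw` (AI4's sharp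
law), AI3 `GroundStatePoincare`.  (§1) The adjacent list `e_j = (j, j+1)` (`m = K`) with identity maps IS chapter R's bare swap: `ptGraphSwap μ e 1 = ptBareSwap μ`.  (§2) The list is
connected; every level `k` is reached from `0` by the chain `0, 1, …, k` of `k ≤ K` listed pairs; the linear test vector `v_k = k` has energy `t` and `Σv² = K(K+1)(2K+1)/6`, so
`ρ ≤ 6t/(K(K+1)(2K+1))` (AI1's Rayleigh ceiling) next to `ρ ≤ h/(K+1)`; AI3 gives `ρ ≥ min{t/(K²(K+1)), h/(2(K+1))}`; AI2's participation bound `Σc/√(Σc²) ≥ √(h/(ρ(1 + K²h/t)))` with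
the two ceilings on `ρ` (cases `K²h ≶ t`) gives `≥ √((K+1)/6)`.  (§3) AI4's sharp law for the ground state of the adjacent list, read for chapter AG's homogeneous ladder
`P = t·ptBareSwap ν^{⊗} + (1−t)·prodKernel w M` (one positive law, exact hot sampler, idle cold kernels, `h = (1−t)w_0`):
**`((1−ρ)/ρ)·log((1−ν(u))√((K+1)/6)/4) ≤ t_mix(1/4) ≤ ⌈(1/ρ)·log(4h/ρ)⌉`, `max{K(K+1)(2K+1)/(6t), (K+1)/h} ≤ 1/ρ ≤ max{K²(K+1)/t, 2(K+1)/h}`** — against AG12's floor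
`(max{K(2K+1)²/(π²t), 2(K+1)/(3πh)} − 1)·(½log(K+1) − log(24√5))` and AG9's ceiling `⌈max{K(2K+1)²/t, π²(K+1)/(2√2h)}·log(4√2K(K+1)(2K+1)/t)⌉`: the same `Θ(max{K³/t, K/h}·log K)`, the
swap unit `K³/3` vs `4K³/π²` on the floor, `K³` vs `4K³` on the ceiling, the hot unit `(K+1)/h` vs `0.21(K+1)/h`, the floor's constant `log(4√6)` vs `log(24√5)`.  No definitions.

* §1 `ptGraphProposal_pathList_eq`, `ptGraphSwap_pathList_eq`; §2 `pathList_connected`, `pathList_reachable`, `sum_range_sq_real`, `pathList_rho_le_linear`, `pathList_participation_ge`;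
  §3 `homLadder_sharp_two_sided`.

Literature grade (cell rule): OWN; nothing cited; no new bib keys.
-/

noncomputable section

open Finset Function Real
open Literature.Probability.MarkovChains

namespace Summit.Ventures.LatticeQCDFlow.Scaling

variable {S : Type*} [Fintype S] [DecidableEq S] {K : ℕ} {ν : S → ℝ} {M : Fin (K + 1) → S → S → ℝ} {w : Fin (K + 1) → ℝ} {t : ℝ}
  {P : (Fin (K + 1) → S) → (Fin (K + 1) → S) → ℝ}

/-! ## §1 The adjacent list is the bare swap -/

omit [Fintype S] in
/-- The graph proposal of the adjacent list with identity maps is chapter R's bare proposal. [ours] -/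
theorem ptGraphProposal_pathList_eq (x y : Fin (K + 1) → S) :
    ptGraphProposal (fun j : Fin K => ((j.castSucc, j.succ) : Fin (K + 1) × Fin (K + 1))) (fun _ => Equiv.refl S) x y = ptBareProposal x y := by
  unfold ptGraphProposal ptBareProposal
  refine sum_congr rfl fun j _ => ?_
  have hne : (j.castSucc : Fin (K + 1)) ≠ j.succ := ne_of_lt Fin.castSucc_lt_succ
  rw [edgeFlowSwap_one hne]
  rfl

/-- **THE ADJACENT LIST'S GRAPH SWAP IS THE BARE SWAP: `ptGraphSwap μ (j ↦ (j, j+1)) 1 = ptBareSwap μ`.** [ours] -/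
theorem ptGraphSwap_pathList_eq (μ : Fin (K + 1) → S → ℝ) :
    ptGraphSwap μ (fun j : Fin K => ((j.castSucc, j.succ) : Fin (K + 1) × Fin (K + 1))) (fun _ => Equiv.refl S) = ptBareSwap μ := by
  unfold ptGraphSwap ptBareSwap
  congr 1
  funext x y
  exact ptGraphProposal_pathList_eq x y

/-! ## §2 The adjacent list: connectivity, chains, the linear test vector, participation -/

omit [Fintype S] [DecidableEq S] in
/-- **The adjacent list is connected:** every non-empty proper set of levels is left by some pair `(j, j+1)`. [ours] -/
theorem pathList_connected (A : Finset (Fin (K + 1))) (hA : A.Nonempty) (hAu : A ≠ univ) :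
    ∃ j : Fin K, (((fun j : Fin K => ((j.castSucc, j.succ) : Fin (K + 1) × Fin (K + 1))) j).1 ∈ A ∧ ((fun j : Fin K => ((j.castSucc, j.succ) : Fin (K + 1) × Fin (K + 1))) j).2 ∉ A)
      ∨ (((fun j : Fin K => ((j.castSucc, j.succ) : Fin (K + 1) × Fin (K + 1))) j).2 ∈ A ∧ ((fun j : Fin K => ((j.castSucc, j.succ) : Fin (K + 1) × Fin (K + 1))) j).1 ∉ A) := by
  by_contra hno
  push Not at hno
  -- no boundary pair: membership is constant along the ladder
  have hconst : ∀ k : Fin (K + 1), (k ∈ A ↔ (0 : Fin (K + 1)) ∈ A) := by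
    intro k
    induction k using Fin.induction with
    | zero => exact Iff.rfl
    | succ j ih =>
      have h1 := (hno j).1
      have h2 := (hno j).2
      dsimp only at h1 h2
      constructor
      · intro hs; exact ih.mp (h2 hs)
      · intro h0; exact h1 (ih.mpr h0)
  obtain ⟨a, ha⟩ := hA
  have h0 : (0 : Fin (K + 1)) ∈ A := (hconst a).mp ha
  exact hAu (eq_univ_of_forall fun k => (hconst k).mpr h0)

omit [Fintype S] [DecidableEq S] in
/-- **Every level `k` is joined to the hot one by the chain `0, 1, …, k` of `k ≤ K` adjacent pairs.** [ours] -/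
theorem pathList_reachable (k : Fin (K + 1)) :
    ∃ n : ℕ, n ≤ K ∧ ∃ γ : Fin (n + 1) → Fin (K + 1), γ 0 = 0 ∧ γ (Fin.last n) = k ∧
      ∀ j : Fin n, ∃ r : Fin K, (((fun j : Fin K => ((j.castSucc, j.succ) : Fin (K + 1) × Fin (K + 1))) r).1 = γ j.castSucc ∧ ((fun j : Fin K => ((j.castSucc, j.succ) : Fin (K + 1) × Fin (K + 1))) r).2 = γ j.succ)
        ∨ (((fun j : Fin K => ((j.castSucc, j.succ) : Fin (K + 1) × Fin (K + 1))) r).1 = γ j.succ ∧ ((fun j : Fin K => ((j.castSucc, j.succ) : Fin (K + 1) × Fin (K + 1))) r).2 = γ j.castSucc) := by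
  have hk : (k : ℕ) ≤ K := Nat.lt_succ_iff.mp k.2
  refine ⟨k, hk, fun j => ⟨j, by omega⟩, by simp, by ext; simp, fun j => ?_⟩
  refine ⟨⟨j, by omega⟩, Or.inl ⟨?_, ?_⟩⟩
  · ext; simp
  · ext; simp

omit [Fintype S] [DecidableEq S] in
/-- `Σ_{k≤K}k² = K(K+1)(2K+1)/6` over `ℝ`. [ours] -/
theorem sum_range_sq_real (K : ℕ) : ∑ k ∈ range (K + 1), ((k : ℝ)) ^ 2 = (K : ℝ) * (K + 1) * (2 * K + 1) / 6 := by
  induction K with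
  | zero => simp
  | succ n ih =>
    rw [Finset.sum_range_succ, ih]
    push_cast
    ring

omit [Fintype S] [DecidableEq S] in
/-- **The linear test vector on the adjacent list:** a positive solution (`t ≥ 0`, `K ≥ 1`) has `ρ ≤ 6t/(K(K+1)(2K+1))`. [ours] -/
theorem pathList_rho_le_linear (hK : 1 ≤ K) (ht : 0 ≤ t) {h ρ : ℝ} {c : Fin (K + 1) → ℝ} (hc : ∀ k, 0 < c k)
    (hvertex : ∀ k : Fin (K + 1), t / K * ∑ r : Fin K, ((if k = ((fun j : Fin K => ((j.castSucc, j.succ) : Fin (K + 1) × Fin (K + 1))) r).1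
        then c ((fun j : Fin K => ((j.castSucc, j.succ) : Fin (K + 1) × Fin (K + 1))) r).2 - c ((fun j : Fin K => ((j.castSucc, j.succ) : Fin (K + 1) × Fin (K + 1))) r).1 else 0)
      + (if k = ((fun j : Fin K => ((j.castSucc, j.succ) : Fin (K + 1) × Fin (K + 1))) r).2
        then c ((fun j : Fin K => ((j.castSucc, j.succ) : Fin (K + 1) × Fin (K + 1))) r).1 - c ((fun j : Fin K => ((j.castSucc, j.succ) : Fin (K + 1) × Fin (K + 1))) r).2 else 0))
      - (if k = 0 then h * c k else 0) = -ρ * c k) :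
    ρ ≤ 6 * t / ((K : ℝ) * (K + 1) * (2 * K + 1)) := by
  have hKpos : (0 : ℝ) < K := Nat.cast_pos.mpr (by omega)
  have hr := groundState_rayleigh (fun j : Fin K => ((j.castSucc, j.succ) : Fin (K + 1) × Fin (K + 1))) hc ht hvertex (fun k => ((k : ℕ) : ℝ))
  dsimp only at hr
  have hE : ∑ r : Fin K, ((((r.castSucc : Fin (K + 1)) : ℕ) : ℝ) - (((r.succ : Fin (K + 1)) : ℕ) : ℝ)) ^ 2 = K := by
    have : ∀ r : Fin K, ((((r.castSucc : Fin (K + 1)) : ℕ) : ℝ) - (((r.succ : Fin (K + 1)) : ℕ) : ℝ)) ^ 2 = 1 := by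
      intro r; rw [Fin.val_castSucc, Fin.val_succ]; push_cast; ring
    simp_rw [this]; simp
  have hV : ∑ k : Fin (K + 1), (((k : ℕ) : ℝ)) ^ 2 = (K : ℝ) * (K + 1) * (2 * K + 1) / 6 := by
    rw [Fin.sum_univ_eq_sum_range (fun i => ((i : ℕ) : ℝ) ^ 2) (K + 1), sum_range_sq_real]
  rw [hE, hV, Fin.val_zero, Nat.cast_zero] at hr
  have h0 : ((0 : ℝ)) ^ 2 = 0 := by norm_num
  rw [h0, mul_zero, add_zero, div_mul_cancel₀ _ hKpos.ne'] at hr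
  rw [le_div_iff₀ (by positivity)]
  linarith

omit [Fintype S] [DecidableEq S] in
/-- **THE PARTICIPATION OF THE ADJACENT LIST'S GROUND STATE: `√((K+1)/6) ≤ Σc/√(Σc²)`** (positive solution, `ρ > 0`, `K ≥ 1`, `t, h > 0`). [ours] -/
theorem pathList_participation_ge (hK : 1 ≤ K) (ht : 0 < t) {h ρ : ℝ} (hh : 0 < h) (hρ : 0 < ρ) {c : Fin (K + 1) → ℝ} (hc : ∀ k, 0 < c k)
    (hvertex : ∀ k : Fin (K + 1), t / K * ∑ r : Fin K, ((if k = ((fun j : Fin K => ((j.castSucc, j.succ) : Fin (K + 1) × Fin (K + 1))) r).1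
        then c ((fun j : Fin K => ((j.castSucc, j.succ) : Fin (K + 1) × Fin (K + 1))) r).2 - c ((fun j : Fin K => ((j.castSucc, j.succ) : Fin (K + 1) × Fin (K + 1))) r).1 else 0)
      + (if k = ((fun j : Fin K => ((j.castSucc, j.succ) : Fin (K + 1) × Fin (K + 1))) r).2
        then c ((fun j : Fin K => ((j.castSucc, j.succ) : Fin (K + 1) × Fin (K + 1))) r).1 - c ((fun j : Fin K => ((j.castSucc, j.succ) : Fin (K + 1) × Fin (K + 1))) r).2 else 0))
      - (if k = 0 then h * c k else 0) = -ρ * c k) :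
    Real.sqrt (((K : ℝ) + 1) / 6) ≤ (∑ k : Fin (K + 1), c k) / Real.sqrt (∑ k : Fin (K + 1), c k ^ 2) := by
  have hKpos : (0 : ℝ) < K := Nat.cast_pos.mpr (by omega)
  have hK1 : (1 : ℝ) ≤ K := by exact_mod_cast hK
  have hpart := groundState_participation_ge (fun j : Fin K => ((j.castSucc, j.succ) : Fin (K + 1) × Fin (K + 1))) hK ht hρ hc hvertex K pathList_reachable
  refine le_trans (Real.sqrt_le_sqrt ?_) hpart
  -- `(K+1)/6 ≤ h/(ρ(1 + K·(K·h/t)))` from the two ceilings on `ρ`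
  have hlin := pathList_rho_le_linear hK ht.le hc hvertex
  have hhot := groundState_rho_le_hot (fun j : Fin K => ((j.castSucc, j.succ) : Fin (K + 1) × Fin (K + 1))) hc ht.le hvertex
  have hq : 0 < 1 + (K : ℝ) * ((K : ℝ) * h / t) := by positivity
  rw [div_le_div_iff₀ (by norm_num) (mul_pos hρ hq)]
  -- goal: `(K+1)·(ρ(1 + K²h/t)) ≤ h·6`
  have hexp : ((K : ℝ) + 1) * (ρ * (1 + (K : ℝ) * ((K : ℝ) * h / t))) = ((K : ℝ) + 1) * ρ + ((K : ℝ) + 1) * ρ * K * K * h / t := by ring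
  rw [hexp]
  have h1 : ((K : ℝ) + 1) * ρ ≤ h := by linarith
  -- the second term: `(K+1)ρK²h/t ≤ 5h` by cases on `K²h ≶ t`
  have h2 : ((K : ℝ) + 1) * ρ * K * K * h / t ≤ 5 * h := by
    rw [div_le_iff₀ ht]
    rcases le_or_gt ((K : ℝ) * K * h) t with hsmall | hlarge
    · -- `K²h ≤ t`: use `(K+1)ρ ≤ h`
      have : ((K : ℝ) + 1) * ρ * K * K * h = (((K : ℝ) + 1) * ρ) * ((K : ℝ) * K * h) := by ring
      rw [this]
      calc (((K : ℝ) + 1) * ρ) * ((K : ℝ) * K * h) ≤ h * t := mul_le_mul h1 hsmall (by positivity) hh.le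
        _ ≤ 5 * h * t := by nlinarith
    · -- `K²h > t`: use `ρ ≤ 6t/(K(K+1)(2K+1))`, i.e. `ρK(K+1)(2K+1) ≤ 6t`, and `K ≤ 2K+1`… precisely `(K+1)ρK²h ≤ 6tKh/(2K+1)·… ≤ 5ht` via `6K ≤ 5(2K+1)`
      have hρ' : ρ * ((K : ℝ) * (K + 1) * (2 * K + 1)) ≤ 6 * t := by
        have := hlin; rwa [le_div_iff₀ (by positivity)] at this
      have hstep : ((K : ℝ) + 1) * ρ * K * K * h * (2 * K + 1) ≤ 6 * t * (K * h) := by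
        have : ((K : ℝ) + 1) * ρ * K * K * h * (2 * K + 1) = (ρ * ((K : ℝ) * (K + 1) * (2 * K + 1))) * (K * h) := by ring
        rw [this]; exact mul_le_mul_of_nonneg_right hρ' (by positivity)
      nlinarith [hstep, mul_pos hKpos hh, mul_pos (mul_pos hKpos hh) ht]
  linarith

/-! ## §3 The sharp law for the homogeneous ladder -/

/-- **THE HOMOGENEOUS LADDER THROUGH THE GROUND STATE:** `K ≥ 1`, `0 < t < 1`, `w` a probability vector with `w_0 > 0`, one positive law `ν`, exact hot sampler, idle cold kernels,
`P = t·ptBareSwap ν^{⊗} + (1−t)·prodKernel w M`, `h = (1−t)w_0`; then there is `ρ` (the adjacent list's ground-state rate) with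
`K(K+1)(2K+1)/(6t) ≤ 1/ρ`, `(K+1)/h ≤ 1/ρ`, `min{t/(K²(K+1)), h/(2(K+1))} ≤ ρ` and, for every content `u`,
**`((1−ρ)/ρ)·log((1−ν(u))·√((K+1)/6)/4) ≤ t_mix(1/4) ≤ ⌈(1/ρ)·log(4h/ρ)⌉`**. [ours] -/
theorem homLadder_sharp_two_sided (hK : 1 ≤ K) (hν : ∀ v, 0 < ν v) (hν1 : ∑ v, ν v = 1) (hM0 : ∀ u v, M 0 u v = ν v)
    (hidle : ∀ i : Fin K, ∀ u v, M i.succ u v = if v = u then 1 else 0) (hw0 : ∀ k, 0 ≤ w k) (hw00 : 0 < w 0) (hw1 : ∑ k, w k = 1) (ht0 : 0 < t) (ht1 : t < 1)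
    (hP : ∀ x y, P x y = t * ptBareSwap (fun _ : Fin (K + 1) => ν) x y + (1 - t) * prodKernel w M x y) (u : S) :
    ∃ ρ : ℝ, 0 < ρ ∧ (K : ℝ) * (K + 1) * (2 * K + 1) / (6 * t) ≤ 1 / ρ ∧ ((K : ℝ) + 1) / ((1 - t) * w 0) ≤ 1 / ρ ∧
      min (t / ((K : ℝ) ^ 2 * (K + 1))) ((1 - t) * w 0 / (2 * ((K : ℝ) + 1))) ≤ ρ ∧
      (1 - ρ) / ρ * Real.log ((1 - ν u) * Real.sqrt (((K : ℝ) + 1) / 6) / 4) ≤ (mixingTime P (tensorFun (fun _ : Fin (K + 1) => ν)) (1 / 4) : ℝ) ∧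
      mixingTime P (tensorFun (fun _ : Fin (K + 1) => ν)) (1 / 4) ≤ ⌈1 / ρ * Real.log (4 * ((1 - t) * w 0) / ρ)⌉₊ := by
  have hKpos : (0 : ℝ) < K := Nat.cast_pos.mpr (by omega)
  have hhh : 0 < (1 - t) * w 0 := mul_pos (by linarith) hw00
  set eK : Fin K → Fin (K + 1) × Fin (K + 1) := fun j => (j.castSucc, j.succ) with heK
  have he : ∀ r, (eK r).1 ≠ (eK r).2 := fun r => ne_of_lt Fin.castSucc_lt_succ
  have hP' : ∀ x y, P x y = t * ptGraphSwap (fun _ : Fin (K + 1) => ν) eK (fun _ => Equiv.refl S) x y + (1 - t) * prodKernel w M x y := by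
    intro x y; rw [hP, heK, ptGraphSwap_pathList_eq]
  -- the ground state of the adjacent list
  obtain ⟨c, ρ, hcpos, hcS, hρ0, hρle, hvertex⟩ := graph_groundState_exists eK (t := t) (h := (1 - t) * w 0) hK ht0 hhh pathList_connected
  have htwo := graphScheme_sharp_two_sided_mode eK hK he hν hν1 hM0 hidle hw0 hw00 hw1 ht0 ht1 hP' hρ0 hcpos hvertex u
  -- sizes
  have hlin := pathList_rho_le_linear hK ht0.le hcpos hvertex
  have hfloorρ := pathList_rho_ge (c := c) (ρ := ρ) hK ht0 hhh (eK := eK) (fun j => rfl) hcpos hvertex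
  have hpart := pathList_participation_ge hK ht0 hhh hρ0 hcpos hvertex
  have hρ1 : ρ < 1 := by
    have hw01 : w 0 ≤ 1 := by
      calc w 0 ≤ ∑ k, w k := Finset.single_le_sum (fun k _ => hw0 k) (mem_univ 0)
        _ = 1 := hw1
    have : (1 - t) * w 0 / ((K : ℝ) + 1) ≤ (1 - t) * w 0 := div_le_self hhh.le (by linarith)
    nlinarith
  refine ⟨ρ, hρ0, ?_, ?_, hfloorρ, le_trans ?_ htwo.1, htwo.2⟩
  · rw [div_le_div_iff₀ (by positivity) hρ0, one_mul]
    have := hlin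
    rw [le_div_iff₀ (by positivity)] at this
    linarith
  · rw [div_le_div_iff₀ hhh hρ0, one_mul]
    calc ((K : ℝ) + 1) * ρ ≤ ((K : ℝ) + 1) * ((1 - t) * w 0 / ((K : ℝ) + 1)) := mul_le_mul_of_nonneg_left hρle (by linarith)
      _ = (1 - t) * w 0 := by field_simp
  · -- the floor's logarithm
    have hνu : ν u ≤ 1 := by
      calc ν u ≤ ∑ v, ν v := Finset.single_le_sum (fun v _ => (hν v).le) (mem_univ u)
        _ = 1 := hν1
    have hcoef : 0 ≤ (1 - ρ) / ρ := div_nonneg (by linarith) hρ0.le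
    rcases eq_or_lt_of_le hνu with heq | hlt
    · rw [heq]; simp
    · have hA : 0 < (1 - ν u) * Real.sqrt (((K : ℝ) + 1) / 6) / 4 := by
        have : 0 < Real.sqrt (((K : ℝ) + 1) / 6) := Real.sqrt_pos.mpr (by positivity)
        have : 0 < 1 - ν u := by linarith
        positivity
      refine floorLog_mono hcoef hA ?_
      have h4 : (1 - ν u) * Real.sqrt (((K : ℝ) + 1) / 6) / 4 = (1 - ν u) / 4 * Real.sqrt (((K : ℝ) + 1) / 6) := by ring
      have h5 : (1 - ν u) * (∑ k : Fin (K + 1), c k) / (4 * Real.sqrt (∑ k : Fin (K + 1), c k ^ 2))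
          = (1 - ν u) / 4 * ((∑ k : Fin (K + 1), c k) / Real.sqrt (∑ k : Fin (K + 1), c k ^ 2)) := by ring
      rw [h4, h5]
      exact mul_le_mul_of_nonneg_left hpart (by linarith)

end Summit.Ventures.LatticeQCDFlow.Scaling

end
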